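import Summits.QuantumFields.YangMills.Theorems.BalabanLadderNTMirrorHankelCap
import Summits.QuantumFields.YangMills.Theorems.BalabanLadderNTCumulantPolarisationDefs
import HarnessLib

/-!
# Crux `NT` (stmt-QuantumFields-19353): the mirror-Hankel layer in the seam's (MF) letters (`mirrorForm`, `cubeSmear`)

Helper file (`--supports stmt-QuantumFields-19353`) of the fleet lead prover of crux `NT` (unit `ym-spine-19353-p1`,
g10), hypothesis-free; plug-compatibility layer of the mirror-Hankel series (`…NTMirrorHankelShift` / `…Hankel` /
`…Convex` / `…Torus` / `…Cap` / `…PSD`).  The seam's clause-(i) discharge lemmas (`MarkovMirrorBare`,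
`MarkovMirrorChiralFloor`, `ConjugateResponse`, `UVSeamRec.MirrorSplitFloors`, …) consume the (MF) floor in the letters of
`CumulantPolarisationDefs`: `X ≤ mirrorForm G r β L Ṽ Ṽ` with `Ṽ = cubeSmear G r c b w` the site-weighted smearing of
the action density carried by a positive-time cube `(c, b)`.  Dictionary and corollary:

* `mirrorForm_eq_latticeConnectedCorr` — `mirrorForm G r β L X Y = latticeConnectedCorr r.ρ β (2L+1) (X∘Θ₀) Y 0`;
* `cubeSmear_translate` — translating a cube smearing by `s e₀` in time is smearing over the translated cube with the
  translated weights: `(cubeSmear c b w) ∘ τ_{−s e₀}… = cubeSmear (c + s e₀) b (w(· − s e₀))`;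
* `mirrorForm_cubeSmear_eq` — hence the (MF) form of the cube `(c + s e₀, b)` is the entry `2s` of the mirror sequence of
  the cube `(c, b)`: `mirrorForm (Ṽ_{c+se₀}) (Ṽ_{c+se₀}) = latticeConnectedCorr (Ṽ_c∘Θ₀) Ṽ_c (2s)`;
* **`mirrorFloor_cubeSmear_caps_gap`** — for a cube `(c, b)` with `0 ≤ c 0`, weights `w`, `|Ṽ_c| ≤ K` (`0 < K`),
  `β ≥ 0`: if `X ≤ mirrorForm G r β L Ṽ_{c+se₀} Ṽ_{c+se₀}` on every torus `L ≥ L₀` (`X > 0`) and the pair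
  `(Ṽ_c∘Θ₀, Ṽ_c)` clusters in the shape of `GapInUnits`, `latticeConnectedCorr r.ρ β (2L+1) (Ṽ_c∘Θ₀) Ṽ_c n ≤ C·e^{−μ n}`
  for all `L ≥ L₀`, `n ≤ L` (`C > 0`), then **`μ · 2s ≤ log(K²/X)`**.

Reading (nothing registered): `s = δ/a(β)` is the lattice offset of the witness cube from the reflection plane; `K ≤ 6N Σ_y |w y|`;
so a β-uniform (MF) floor and the IR leg's clustering at rate `μ = c₁ a(β)` of the SAME smeared density coexist only if
`2δ c₁ ≤ log(K²/X) = 8 log(1/a(β)) + O(1)`.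

Refs: K. Osterwalder, E. Seiler, Ann. Phys. 110 (1978) 440, §2; J. Glimm, A. Jaffe, *Quantum Physics* (1987) §6.1.
-/

set_option autoImplicit false

noncomputable section

open MeasureTheory Finset
open Literature.MathematicalPhysics.QuantumFieldTheory Literature.MathematicalPhysics.QuantumLattice
open Literature.Probability.LatticeModels
open Summit.QuantumFields.YangMills.Cruxes.OSLegsFromFemtoAndGap.DlrCollarTransfer
open Summit.QuantumFields.YangMills.Cruxes.OSLegsFromFemtoAndGap.DlrCollarTransfer.StubLower (mem_cubeSites_iff)
open Summit.QuantumFields.YangMills.Cruxes.NT.BoundaryLaw (dens_configShift)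
open Summit.QuantumFields.YangMills.Cruxes.NT.CumulantPolarisation

namespace Summit.QuantumFields.YangMills.Cruxes.NT.MirrorHankel

variable (G : Type) [Group G] [TopologicalSpace G] [IsTopologicalGroup G] [CompactSpace G]
  [MeasurableSpace G] [BorelSpace G] (r : LatticeRep G)

/-! ## §1 Dictionary -/

/-- **The seam's mirror form is the lag-`0` mirror correlator**:
`mirrorForm G r β L X Y = latticeConnectedCorr r.ρ β (2L+1) (X∘Θ₀) Y 0`. [folklore] -/
theorem mirrorForm_eq_latticeConnectedCorr (β : ℝ) (L : ℕ) (X Y : LGConfig 4 G → ℝ) :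
    mirrorForm G r β L X Y = latticeConnectedCorr r.ρ β (2 * L + 1) (fun V => X (cfgReflect V)) Y 0 := by
  have h0 : ∀ V : LGConfig 4 G, configShift (0 : Literature.Probability.LatticeModels.Site 4) V = V := fun V => by
    funext e; simp [Literature.MathematicalPhysics.QuantumLattice.configShift_apply]
  unfold mirrorForm latticeConnectedCorr torusE
  simp only [Nat.cast_zero, Pi.single_zero, neg_zero, h0]

/-- **Translating a cube smearing**: `Ṽ_{(c,b),w} (τ₋ᵥ… V) = Ṽ_{(c+v,b), w(·−v)} V`, i.e.
`cubeSmear c b w (configShift (−v) V) = cubeSmear (c + v) b (fun y => w (y − v)) V`. [folklore] -/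
theorem cubeSmear_translate (c v : Fin 4 → ℤ) (b : ℕ) (w : (Fin 4 → ℤ) → ℝ) (V : LGConfig 4 G) :
    cubeSmear G r c b w (configShift (-v) V) = cubeSmear G r (c + v) b (fun y => w (y - v)) V := by
  unfold cubeSmear
  have hdens : ∀ y : Fin 4 → ℤ, dens G r y (configShift (-v) V) = dens G r (y + v) V := fun y => by
    have h := dens_configShift G r (-v) (y + v) V
    rwa [add_neg_cancel_right] at h
  simp only [hdens]
  refine Finset.sum_equiv (Equiv.addRight v) (fun y => ?_) (fun y _ => ?_)
  · simp only [Equiv.coe_addRight, mem_cubeSites_iff, Pi.add_apply]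
    constructor
    · intro h j; have := h j; constructor <;> linarith [this.1, this.2]
    · intro h j; have := h j; constructor <;> linarith [this.1, this.2]
  · simp only [Equiv.coe_addRight, add_sub_cancel_right]

/-- **The (MF) form of a translated cube is an entry of the base cube's mirror sequence**:
`mirrorForm Ṽ_{c+se₀} Ṽ_{c+se₀} = latticeConnectedCorr (Ṽ_c∘Θ₀) Ṽ_c (2s)` (`Ṽ_c = cubeSmear c b w`,
`Ṽ_{c+se₀} = cubeSmear (c + s e₀) b (w(· − s e₀))`). [cite: OsterwalderSeiler1978, §2] -/
theorem mirrorForm_cubeSmear_eq (β : ℝ) (L : ℕ) (c : Fin 4 → ℤ) (b s : ℕ) (w : (Fin 4 → ℤ) → ℝ) :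
    mirrorForm G r β L (cubeSmear G r (c + Pi.single 0 (s : ℤ)) b (fun y => w (y - Pi.single 0 (s : ℤ))))
        (cubeSmear G r (c + Pi.single 0 (s : ℤ)) b (fun y => w (y - Pi.single 0 (s : ℤ)))) =
      latticeConnectedCorr r.ρ β (2 * L + 1) (fun V => cubeSmear G r c b w (cfgReflect V)) (cubeSmear G r c b w)
        (2 * s) := by
  rw [← torusMirrorCov_self_eq G r β L (cubeSmear G r c b w) s]
  unfold mirrorForm
  simp only [cubeSmear_translate]

/-! ## §2 The cap in (MF) letters -/

/-- The links read by a cube smearing of the cube `(c, b)` with `0 ≤ c 0` are based at times in `[0, c 0 + b]` — the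
window hypothesis of the mirror-Hankel layer with `T = c 0 + b + 1`, for ANY support set inside the cube window.
[folklore] -/
theorem window_of_cube {c : Fin 4 → ℤ} {b : ℕ} (hc0 : 0 ≤ c 0)
    {SW : Finset (Literature.MathematicalPhysics.QuantumLattice.ZdEdge 4)}
    (hSW : ∀ e ∈ SW, ∀ j, c j ≤ e.1 j ∧ e.1 j ≤ c j + b) :
    ∀ e ∈ SW, 0 ≤ e.1 0 ∧ e.1 0 + 1 ≤ ((c 0).toNat + b + 1 : ℕ) := by
  intro e he
  have h := hSW e he 0
  have hc : ((c 0).toNat : ℤ) = c 0 := Int.toNat_of_nonneg hc0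
  refine ⟨le_trans hc0 h.1, ?_⟩
  push_cast
  linarith [h.2]

variable {G} {r}

/-- **(MF) floor of a translated cube × `GapInUnits`-shape clustering of the base cube ⇒ `μ · 2s ≤ log(K²/X)`.**
For a cube `(c, b)` with `0 ≤ c 0`, weights `w`, the smearing `Ṽ_c = cubeSmear G r c b w` measurable (e.g. continuous,
`continuous_cubeSmear'`, under `r.secondCountableTopology`) with `|Ṽ_c| ≤ K`, `0 < K`, carried by a link set `SW` in
the cube window, and `β ≥ 0`: if the seam's mirror floor `X ≤ mirrorForm G r β L Ṽ_{c+se₀} Ṽ_{c+se₀}` (`X > 0`) holds on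
every torus `L ≥ L₀` and `latticeConnectedCorr r.ρ β (2L+1) (Ṽ_c∘Θ₀) Ṽ_c n ≤ C·e^{−μ n}` for all `L ≥ L₀`, `n ≤ L`
(`C > 0`), then `μ · (2s) ≤ log (K²/X)`. [cite: GlimmJaffe1987, §6.1] -/
theorem mirrorFloor_cubeSmear_caps_gap {β : ℝ} (hβ : 0 ≤ β) {c : Fin 4 → ℤ} {b : ℕ} (hc0 : 0 ≤ c 0)
    {w : (Fin 4 → ℤ) → ℝ} (hWm : Measurable (cubeSmear G r c b w)) {K : ℝ} (hKpos : 0 < K)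
    (hK : ∀ V, |cubeSmear G r c b w V| ≤ K)
    {SW : Finset (Literature.MathematicalPhysics.QuantumLattice.ZdEdge 4)} (hWS : IsCylinder (cubeSmear G r c b w) SW)
    (hSW : ∀ e ∈ SW, ∀ j, c j ≤ e.1 j ∧ e.1 j ≤ c j + b) {s L₀ : ℕ} {X C μ : ℝ} (hX : 0 < X) (hC : 0 < C)
    (hfloor : ∀ L : ℕ, L₀ ≤ L →
      X ≤ mirrorForm G r β L (cubeSmear G r (c + Pi.single 0 (s : ℤ)) b (fun y => w (y - Pi.single 0 (s : ℤ))))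
        (cubeSmear G r (c + Pi.single 0 (s : ℤ)) b (fun y => w (y - Pi.single 0 (s : ℤ)))))
    (hgap : ∀ L : ℕ, L₀ ≤ L → ∀ n : ℕ, n ≤ L →
      latticeConnectedCorr r.ρ β (2 * L + 1) (fun V => cubeSmear G r c b w (cfgReflect V)) (cubeSmear G r c b w) n ≤
        C * Real.exp (-(μ * n))) :
    μ * (2 * s : ℕ) ≤ Real.log (K ^ 2 / X) :=
  mul_le_log_of_mirrorFloor_of_gapShape (r := r) (T := (c 0).toNat + b + 1) hβ hWm hKpos hK hWS
    (window_of_cube hc0 hSW) hX hC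
    (fun L hL => by rw [← mirrorForm_cubeSmear_eq]; exact hfloor L hL) hgap

end Summit.QuantumFields.YangMills.Cruxes.NT.MirrorHankel

end
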